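import Literature.NumberTheory.EllipticCurves.IsogenySelmerInfty
import Literature.NumberTheory.EllipticCurves.IwasawaDualFunctorialityProofs
import Literature.NumberTheory.EllipticCurves.Castella2018.AnticyclotomicSelmerDualModuleFinite
import HarnessLib

/-!
# Crux `MazurMCOnX1RankZero` (item stmt-BirchSwinnertonDyer-19035), line `interlude_with_torsion`:
# the map `Sel_𝔭^Σ(K_∞, f)` of Castella's Selmer groups along a `Γ_K`-equivariant map `f : E(K̄) → E'(K̄)`,
# and its `Λ`-linear transpose on the duals `𝔛 = AcSelmer.XAc`

Cell `bsd-eis` (host `run/shared/lean/pub/bsd-eis/`), LEAD `cruxlead-19035` (g0); `--supports`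
stmt-BirchSwinnertonDyer-19035 as a HELPER. Content = §K2e (A)–(C) of the bsd-idea-11 supplement line
`Cruxes/MazurMCOnX1RankZero/Lines/interlude_stepsTwoThree_split_idea11g6.lean` (REV 7, kernel-checked there;
author of the mathematics: seat bsd-idea-11 g13), moved verbatim into the tree so that the reshaped skeleton of record
(v8) and the road-B stub `stub_roadBResidueP` (whose signature is stated with `K2e.acSelmerMap`) can import it.
Galois-cohomology plumbing, UNCONDITIONAL and kernel-checked; NOTHING is asserted about BSD, Mazur's main conjecture or
IMC2; the crux stays OPEN.

WHAT. For a number field `K`, Weierstrass curves `W, W'` over `K`, a prime `p`, a `ℤ_p`-extension `κ`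
(`K_∞ = K̄^{ker κ}`), a prime `𝔭` (the STRICT place) and a set `Σ` of finite places:
* §A — for any closed `H ≤ Γ_K`, `H¹(H, f)` (`IsogenySelmerInfty.h1Map`) respects the three local kernels of
  Castella's `AcSelmer.selmerOver H · p 𝔭 Σ` (away from `p`: `awayKer`; archimedean: `infKer`; strict at `𝔭`:
  through the induced map `strictGrMap` on `E[p^∞]/0`), hence maps `Sel_𝔭^Σ(L, E[p^∞])` into `Sel_𝔭^Σ(L, E'[p^∞])`
  (`h1Map_mem_acSelmerOver`).
* §B — `acSelmerMap p κ 𝔭 Σ f hf : selmerAc W p κ 𝔭 Σ →+ selmerAc W' p κ 𝔭 Σ`, with `Sel(g) ∘ Sel(f) = n •` when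
  `g ∘ f = [n]` (`acSelmerMap_acSelmerMap_of_comp_eq_nsmul`) and compatibility with `conj_γ`
  (`acSelmerMap_conjSelmerAc`).
* §C — the `Λ`-LINEAR transpose `𝔛(E') → 𝔛(E)` exists (`exists_transpose`, from `XAc.isDualPair` and
  `IwasawaDual.IsDualPair.exists_linearMap_comp`) and `ᵗSel(f) ∘ ᵗSel(g) = n •` (`transpose_comp_eq_smul`).

A sibling API for the OTHER copy of these Selmer groups (`Summit.BirchSwinnertonDyer.Rank1Residual.X11b.AcSelmer`,
`coeffMapH1` / `selmerAcMap` / `xacComap`) is `Theorems/SchneiderFreeAdditiveX3AnticyclotomicSelmerIsogeny.lean`; the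
present file serves the `Literature.….Castella2018.AcSelmer` objects in which crux 2, Kobayashi–Ota Prop. 2.9 and this
crux's currencies are typed. References: Serre, *Galois Cohomology* I.§2.4; Greenberg 1989 §1 (p. 98); Castella 2018
Def. 2.2 (arXiv:1704.06608 p. 5); Greenberg, LNM 1716 §1 (p. 60).
-/

set_option linter.dupNamespace false
set_option autoImplicit false

noncomputable section

open scoped Classical

open WeierstrassCurve NumberField IsDedekindDomain Field
  Literature.NumberTheory.EllipticCurves Literature.NumberTheory.GaloisRepresentations
  Literature.NumberTheory.EllipticCurves.Castella2018

namespace Summit.BirchSwinnertonDyer.BirchSwinnertonDyer.Theorems.InterludeWithTorsion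

namespace K2e

universe u

open IsogenySelmerInfty GreenbergSelmer AcSelmer

/-! ## §A. `H¹(H, f)` respects the three local kernels of `Sel_𝔭^Σ(L, ·)` -/

section SelLevel

variable {K : Type u} [Field K] [NumberField K] {W W' : WeierstrassCurve K} (p : ℕ)
  (H : Subgroup (absoluteGaloisGroup K))

omit [NumberField K] in
/-- Restriction to a smaller subgroup commutes with `H¹(f)` (functoriality, `resH1Hom_comp`).
[cite: NeukirchSchmidtWingberg2008, I.§5] -/
theorem resOfLe_comp_h1Map {H₀ : Subgroup (absoluteGaloisGroup K)} (h : H₀ ≤ H)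
    (f : W.geomPoints →+ W'.geomPoints)
    (hf : ∀ (σ : absoluteGaloisGroup K) (P : W.geomPoints), f (σ • P) = σ • f P) :
    (Literature.NumberTheory.EllipticCurves.resOfLe (↥(W'.geomPrimaryTorsion p)) h).comp
        (h1Map p H f hf) =
      (h1Map p H₀ f hf).comp
        (Literature.NumberTheory.EllipticCurves.resOfLe (↥(W.geomPrimaryTorsion p)) h) := by
  unfold h1Map Literature.NumberTheory.EllipticCurves.resOfLe
  erw [resH1Hom_comp, resH1Hom_comp]
  exact resH1Hom_congr (by ext; rfl) (by ext; rfl) _ _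

/-- `H¹(f)` preserves the local condition away from `p` (`awayKer`). [cite: EmertonPollackWeston2006, §3.1] -/
theorem h1Map_mem_awayKer (f : W.geomPoints →+ W'.geomPoints)
    (hf : ∀ (σ : absoluteGaloisGroup K) (P : W.geomPoints), f (σ • P) = σ • f P)
    (v : HeightOneSpectrum (𝓞 K)) {c : W.subgroupH1 p H}
    (hc : c ∈ awayKer H (↥(W.geomPrimaryTorsion p)) v) :
    h1Map p H f hf c ∈ awayKer H (↥(W'.geomPrimaryTorsion p)) v := by
  rw [awayKer, AddMonoidHom.mem_ker, ← AddMonoidHom.comp_apply, resOfLe_comp_h1Map,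
    AddMonoidHom.comp_apply,
    (AddMonoidHom.mem_ker.1 hc : Literature.NumberTheory.EllipticCurves.resOfLe _ _ c = 0), map_zero]

omit [NumberField K] in
/-- `H¹(f)` preserves the local condition at the infinite places (`infKer`). [cite: Greenberg1989, §1 p. 98 (3)] -/
theorem h1Map_mem_infKer (f : W.geomPoints →+ W'.geomPoints)
    (hf : ∀ (σ : absoluteGaloisGroup K) (P : W.geomPoints), f (σ • P) = σ • f P)
    (w : InfinitePlace K) {c : W.subgroupH1 p H}
    (hc : c ∈ infKer H (↥(W.geomPrimaryTorsion p)) w) :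
    h1Map p H f hf c ∈ infKer H (↥(W'.geomPrimaryTorsion p)) w := by
  rw [infKer, AddMonoidHom.mem_ker, ← AddMonoidHom.comp_apply, resOfLe_comp_h1Map,
    AddMonoidHom.comp_apply,
    (AddMonoidHom.mem_ker.1 hc : Literature.NumberTheory.EllipticCurves.resOfLe _ _ c = 0), map_zero]

/-- The map `E[p^∞]/0 → E'[p^∞]/0` on the graded pieces of the STRICT data induced by `f`.
[cite: Greenberg1989, §1 p. 98 (4)] -/
def strictGrMap (f : W.geomPoints →+ W'.geomPoints) (𝔭 : HeightOneSpectrum (𝓞 K)) :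
    (strictDatum (↥(W.geomPrimaryTorsion p)) 𝔭).Gr →+ (strictDatum (↥(W'.geomPrimaryTorsion p)) 𝔭).Gr :=
  QuotientAddGroup.map _ _ (primaryTorsionMap p f) fun m hm ↦ by
    have hm0 : m = 0 := (AddSubgroup.mem_bot).1 hm
    rw [AddSubgroup.mem_comap, hm0, map_zero]
    exact AddSubgroup.zero_mem _

/-- `strictGrMap` on classes. [cite: Greenberg1989, §1 p. 98 (4)] -/
@[simp]
theorem strictGrMap_grMk (f : W.geomPoints →+ W'.geomPoints) (𝔭 : HeightOneSpectrum (𝓞 K))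
    (m : ↥(W.geomPrimaryTorsion p)) :
    strictGrMap p f 𝔭 ((strictDatum (↥(W.geomPrimaryTorsion p)) 𝔭).grMk m) =
      (strictDatum (↥(W'.geomPrimaryTorsion p)) 𝔭).grMk (primaryTorsionMap p f m) :=
  rfl

/-- `strictGrMap` commutes with the action of `H ⊓ D_𝔭`. [cite: Greenberg1989, §1 p. 98 (4)] -/
theorem strictGrMap_smul (f : W.geomPoints →+ W'.geomPoints)
    (hf : ∀ (σ : absoluteGaloisGroup K) (P : W.geomPoints), f (σ • P) = σ • f P)
    (𝔭 : HeightOneSpectrum (𝓞 K)) (x : decompIn H 𝔭)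
    (q : (strictDatum (↥(W.geomPrimaryTorsion p)) 𝔭).Gr) :
    strictGrMap p f 𝔭 (ContinuousMonoidHom.id (decompIn H 𝔭) x • q) = x • strictGrMap p f 𝔭 q := by
  obtain ⟨m, rfl⟩ := (strictDatum (↥(W.geomPrimaryTorsion p)) 𝔭).grMk_surjective q
  change strictGrMap p f 𝔭 ((x : decomp (K := K) 𝔭) • (strictDatum _ 𝔭).grMk m) =
    (x : decomp (K := K) 𝔭) • strictGrMap p f 𝔭 ((strictDatum _ 𝔭).grMk m)
  rw [LocalDatum.smul_grMk, strictGrMap_grMk, strictGrMap_grMk, LocalDatum.smul_grMk,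
    primaryTorsionMap_smul p f hf]

/-- **The strict local map commutes with `H¹(f)`**: `str' ∘ H¹(H, f) = H¹(H ⊓ D_𝔭, f̄) ∘ str`, both
composites being induced by the compatible pair (`H ⊓ D_𝔭 ↪ H`, `m ↦ f m mod 0`).
[cite: NeukirchSchmidtWingberg2008, I.§5] -/
theorem strictMap_comp_h1Map (f : W.geomPoints →+ W'.geomPoints)
    (hf : ∀ (σ : absoluteGaloisGroup K) (P : W.geomPoints), f (σ • P) = σ • f P)
    (𝔭 : HeightOneSpectrum (𝓞 K)) :
    ((strictDatum (↥(W'.geomPrimaryTorsion p)) 𝔭).strictMap H).comp (h1Map p H f hf) =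
      (resH1Hom (ContinuousMonoidHom.id (decompIn H 𝔭)) (strictGrMap p f 𝔭)
          (strictGrMap_smul p H f hf 𝔭)).comp
        ((strictDatum (↥(W.geomPrimaryTorsion p)) 𝔭).strictMap H) := by
  unfold h1Map LocalDatum.strictMap
  erw [resH1Hom_comp, resH1Hom_comp]
  exact resH1Hom_congr (by ext; rfl) (by ext; rfl) _ _

/-- `H¹(f)` preserves the STRICT local condition at `𝔭`. [cite: Greenberg1989, §1 p. 98] -/
theorem h1Map_mem_strictKer (f : W.geomPoints →+ W'.geomPoints)
    (hf : ∀ (σ : absoluteGaloisGroup K) (P : W.geomPoints), f (σ • P) = σ • f P)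
    (𝔭 : HeightOneSpectrum (𝓞 K)) {c : W.subgroupH1 p H}
    (hc : c ∈ (strictDatum (↥(W.geomPrimaryTorsion p)) 𝔭).strictKer H) :
    h1Map p H f hf c ∈ (strictDatum (↥(W'.geomPrimaryTorsion p)) 𝔭).strictKer H := by
  rw [LocalDatum.mem_strictKer_iff, ← AddMonoidHom.comp_apply, strictMap_comp_h1Map p H f hf 𝔭,
    AddMonoidHom.comp_apply, ((strictDatum _ 𝔭).mem_strictKer_iff H c).1 hc, map_zero]

variable [H.Normal]

/-- **`H¹(H, f)` maps `Sel_𝔭^Σ(L, E[p^∞])` into `Sel_𝔭^Σ(L, E'[p^∞])`** (every conjugate of every local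
condition is respected: `h1Map_conjH1` + the three lemmas above). [cite: Castella2018, Def. 2.2 (arXiv:1704.06608 p. 5)] -/
theorem h1Map_mem_acSelmerOver (f : W.geomPoints →+ W'.geomPoints)
    (hf : ∀ (σ : absoluteGaloisGroup K) (P : W.geomPoints), f (σ • P) = σ • f P)
    {𝔭 : HeightOneSpectrum (𝓞 K)} {S : Set (HeightOneSpectrum (𝓞 K))} {c : W.subgroupH1 p H}
    (hc : c ∈ AcSelmer.selmerOver H (↥(W.geomPrimaryTorsion p)) p 𝔭 S) :
    h1Map p H f hf c ∈ AcSelmer.selmerOver H (↥(W'.geomPrimaryTorsion p)) p 𝔭 S := by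
  have e : ∀ σ : absoluteGaloisGroup K,
      Literature.NumberTheory.EllipticCurves.conjH1 H (↥(W'.geomPrimaryTorsion p)) σ (h1Map p H f hf c) =
        h1Map p H f hf (Literature.NumberTheory.EllipticCurves.conjH1 H (↥(W.geomPrimaryTorsion p)) σ c) :=
    fun σ ↦ (h1Map_conjH1 p H f hf σ c).symm
  rw [AcSelmer.mem_selmerOver_iff] at hc ⊢
  refine ⟨fun v hv hvS σ ↦ ?_, fun w σ ↦ ?_, fun σ ↦ ?_⟩
  · rw [e]; exact h1Map_mem_awayKer p H f hf v (hc.1 v hv hvS σ)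
  · rw [e]; exact h1Map_mem_infKer p H f hf w (hc.2.1 w σ)
  · rw [e]; exact h1Map_mem_strictKer p H f hf 𝔭 (hc.2.2 σ)

end SelLevel

/-! ## §B. `Sel_𝔭^Σ(f) : Sel_𝔭^Σ(K_∞, E[p^∞]) → Sel_𝔭^Σ(K_∞, E'[p^∞])` -/

section AcSel

variable {K : Type u} [Field K] [NumberField K] {W W' : WeierstrassCurve K} (p : ℕ) [Fact p.Prime]
  (κ : ZpExtension K p) (𝔭 : HeightOneSpectrum (𝓞 K)) (S : Set (HeightOneSpectrum (𝓞 K)))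

/-- `H¹(K_∞, f)` maps `Sel_𝔭^Σ(K_∞, E[p^∞])` into `Sel_𝔭^Σ(K_∞, E'[p^∞])`. [cite: Castella2018, Def. 2.2 (arXiv:1704.06608 p. 5)] -/
theorem h1Map_mem_selmerAc (f : W.geomPoints →+ W'.geomPoints)
    (hf : ∀ (σ : absoluteGaloisGroup K) (P : W.geomPoints), f (σ • P) = σ • f P)
    {c : W.subgroupH1 p κ.kerSubgroup} (hc : c ∈ selmerAc W p κ 𝔭 S) :
    h1Map p κ.kerSubgroup f hf c ∈ selmerAc W' p κ 𝔭 S :=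
  h1Map_mem_acSelmerOver p κ.kerSubgroup f hf hc

/-- **`Sel_𝔭^Σ(f)`**, the restriction of `H¹(K_∞, f)` to Castella's Selmer groups. [cite: Castella2018, Def. 2.2 (arXiv:1704.06608 p. 5)] -/
def acSelmerMap (f : W.geomPoints →+ W'.geomPoints)
    (hf : ∀ (σ : absoluteGaloisGroup K) (P : W.geomPoints), f (σ • P) = σ • f P) :
    selmerAc W p κ 𝔭 S →+ selmerAc W' p κ 𝔭 S :=
  ((h1Map p κ.kerSubgroup f hf).comp (selmerAc W p κ 𝔭 S).subtype).codRestrict _ fun c ↦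
    h1Map_mem_selmerAc p κ 𝔭 S f hf c.2

/-- Unfolding `acSelmerMap` on classes. [cite: Castella2018, Def. 2.2 (arXiv:1704.06608 p. 5)] -/
@[simp]
theorem coe_acSelmerMap_apply (f : W.geomPoints →+ W'.geomPoints)
    (hf : ∀ (σ : absoluteGaloisGroup K) (P : W.geomPoints), f (σ • P) = σ • f P)
    (c : selmerAc W p κ 𝔭 S) :
    (acSelmerMap p κ 𝔭 S f hf c : W'.subgroupH1 p κ.kerSubgroup) = h1Map p κ.kerSubgroup f hf c :=
  rfl

/-- **`Sel_𝔭^Σ(g) ∘ Sel_𝔭^Σ(f) = n`** when `g ∘ f = [n]`. [cite: SerreGaloisCohomology1997, I.§2.4 (functoriality of H¹ for compatible pairs)] -/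
theorem acSelmerMap_acSelmerMap_of_comp_eq_nsmul (f : W.geomPoints →+ W'.geomPoints)
    (hf : ∀ (σ : absoluteGaloisGroup K) (P : W.geomPoints), f (σ • P) = σ • f P)
    (g : W'.geomPoints →+ W.geomPoints)
    (hg : ∀ (σ : absoluteGaloisGroup K) (Q : W'.geomPoints), g (σ • Q) = σ • g Q)
    {n : ℕ} (h : ∀ P : W.geomPoints, g (f P) = (n : ℤ) • P) (c : selmerAc W p κ 𝔭 S) :
    acSelmerMap p κ 𝔭 S g hg (acSelmerMap p κ 𝔭 S f hf c) = n • c := by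
  apply Subtype.ext
  rw [coe_acSelmerMap_apply, coe_acSelmerMap_apply, AddSubgroupClass.coe_nsmul]
  exact h1Map_h1Map_of_comp_eq_nsmul p κ.kerSubgroup f hf g hg h c

/-- `Sel_𝔭^Σ(f)` commutes with the `Γ`-action `conj_γ`. [cite: Castella2018, §2.1–2.2 (arXiv:1704.06608 p. 5), the `Γ`-action on `Sel_𝔭^Σ`] -/
theorem acSelmerMap_conjSelmerAc (f : W.geomPoints →+ W'.geomPoints)
    (hf : ∀ (σ : absoluteGaloisGroup K) (P : W.geomPoints), f (σ • P) = σ • f P)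
    (γ : absoluteGaloisGroup K) (c : selmerAc W p κ 𝔭 S) :
    acSelmerMap p κ 𝔭 S f hf (conjSelmerAc W p κ 𝔭 S γ c) =
      conjSelmerAc W' p κ 𝔭 S γ (acSelmerMap p κ 𝔭 S f hf c) := by
  apply Subtype.ext
  rw [coe_acSelmerMap_apply, coe_conjSelmerAc_apply, coe_conjSelmerAc_apply, coe_acSelmerMap_apply]
  exact h1Map_conjH1 p κ.kerSubgroup f hf γ c

/-! ## §C. The `Λ`-linear transposes on `𝔛 = Hom(Sel_𝔭^Σ, ℚ/ℤ)` and their composite -/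

variable (γ : absoluteGaloisGroup K) [Fact (κ.IsTopGenerator γ)]

/-- Evaluation of a character at a Selmer class, as a homomorphism on `𝔛`. [folklore] -/
def evalAt (s : selmerAc W p κ 𝔭 S) : XAc W p κ 𝔭 S γ →+ AddCircle (1 : ℚ) where
  toFun x := x s
  map_zero' := rfl
  map_add' _ _ := rfl

/-- Unfolding `evalAt`. [folklore] -/
@[simp]
theorem evalAt_apply (s : selmerAc W p κ 𝔭 S) (x : XAc W p κ 𝔭 S γ) : evalAt p κ 𝔭 S γ s x = x s :=
  rfl

/-- **The `Λ`-LINEAR transpose `𝔛(E') → 𝔛(E)` of `Sel_𝔭^Σ(f)`** (precomposition of characters; `Λ`-linear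
because `Sel_𝔭^Σ(f)` intertwines `conj_γ` and both duals are dual pairs, `XAc.isDualPair` +
`IwasawaDual.IsDualPair.exists_linearMap_comp`). [cite: GreenbergLNM1716, §1 p. 60] -/
theorem exists_transpose (f : W.geomPoints →+ W'.geomPoints)
    (hf : ∀ (σ : absoluteGaloisGroup K) (P : W.geomPoints), f (σ • P) = σ • f P) :
    ∃ F : XAc W' p κ 𝔭 S γ →ₗ[IwasawaAlgebra p] XAc W p κ 𝔭 S γ,
      ∀ (x : XAc W' p κ 𝔭 S γ) (s : selmerAc W p κ 𝔭 S), F x s = x (acSelmerMap p κ 𝔭 S f hf s) := by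
  obtain ⟨F, hF⟩ := (XAc.isDualPair W' p κ 𝔭 S γ).exists_linearMap_comp (XAc.isDualPair W p κ 𝔭 S γ)
    (acSelmerMap p κ 𝔭 S f hf) fun s ↦ by
      rw [IwasawaDual.End_sub_apply, IwasawaDual.End_sub_apply, AddMonoid.End.one_apply,
        AddMonoid.End.one_apply, map_sub, acSelmerMap_conjSelmerAc]
  exact ⟨F, fun x s ↦ hF x s⟩

/-- **`ᵗSel(f) ∘ ᵗSel(g) = n` on `𝔛(E)`** when `g ∘ f = [n]` on `E`. [cite: GreenbergLNM1716, §1 (paragraph before Conj. 1.11)] -/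
theorem transpose_comp_eq_smul (f : W.geomPoints →+ W'.geomPoints)
    (hf : ∀ (σ : absoluteGaloisGroup K) (P : W.geomPoints), f (σ • P) = σ • f P)
    (g : W'.geomPoints →+ W.geomPoints)
    (hg : ∀ (σ : absoluteGaloisGroup K) (Q : W'.geomPoints), g (σ • Q) = σ • g Q)
    {n : ℕ} (h : ∀ P : W.geomPoints, g (f P) = (n : ℤ) • P)
    (F : XAc W' p κ 𝔭 S γ →ₗ[IwasawaAlgebra p] XAc W p κ 𝔭 S γ)
    (hF : ∀ (x : XAc W' p κ 𝔭 S γ) (s : selmerAc W p κ 𝔭 S), F x s = x (acSelmerMap p κ 𝔭 S f hf s))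
    (G : XAc W p κ 𝔭 S γ →ₗ[IwasawaAlgebra p] XAc W' p κ 𝔭 S γ)
    (hG : ∀ (y : XAc W p κ 𝔭 S γ) (t : selmerAc W' p κ 𝔭 S), G y t = y (acSelmerMap p κ 𝔭 S g hg t))
    (y : XAc W p κ 𝔭 S γ) : F (G y) = (n : IwasawaAlgebra p) • y := by
  rw [Nat.cast_smul_eq_nsmul]
  refine DFunLike.ext _ _ fun s ↦ ?_
  rw [hF, hG, acSelmerMap_acSelmerMap_of_comp_eq_nsmul p κ 𝔭 S f hf g hg h, map_nsmul,
    ← evalAt_apply p κ 𝔭 S γ s (n • y), map_nsmul, evalAt_apply]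

end AcSel

end K2e

end Summit.BirchSwinnertonDyer.BirchSwinnertonDyer.Theorems.InterludeWithTorsion

end
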